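import Summits.ResolutionOfSingularities.ResolutionOfSingularities.Theorems.ValuativeLuAlphaPTorsorAdaptedDefs
import Summits.ResolutionOfSingularities.ResolutionOfSingularities.Theorems.ValuativeLuAlphaPTorsorAPDict
import Summits.ResolutionOfSingularities.ResolutionOfSingularities.Theorems.ValuativeLuAlphaPTorsorAPLift
import Summits.ResolutionOfSingularities.ResolutionOfSingularities.Theorems.ValuativeLuAlphaPTorsorPerronExplicit
import Literature.AlgebraicGeometry.Resolution.CompositeValuations
import Mathlib.Algebra.Algebra.Subalgebra.Lattice
import HarnessLib

/-!
# S3* level induction: the one-level (rank-one) case, value torsion in the residue field, residues of adjoined rings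

Crux `Valuative.LuAlphaPTorsor` (stmt-ResolutionOfSingularities-0641), line `pfaff-line-log-final-forms`,
lead seat c4 — pieces of `ap_adaptedPerron` (`…AdaptedPerron`, Perron monomialization on
flag-adapted charts in any rank), split by the 400-line rule:
* `ap_residue_adjoin_mem` (registered anchor, closed form) / `ap_residue_adjoin_surj` — residues
  of `k[S ∪ ws]` lie in a residual subalgebra containing the residues of `S` and of `ws`, and
  every element of `k[T₀ ∪ x̄s]` lifts;
* `ap_ap_torsV` — value torsion passes to the residue field of the top coarsening;
* `ap_ap_oneLevel` — a ONE-LEVEL flag-adapted chart with value torsion is of rank one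
  (`LevelArchimedean` + torsion), so the landed rank-one `perronMonomialization_explicit` applies
  and its output is flag-adapted again. [folklore]
-/

set_option linter.dupNamespace false

open IsLocalRing

namespace Summit.ResolutionOfSingularities.ResolutionOfSingularities.Theorems.PfaffLine

open Literature.AlgebraicGeometry.Resolution

/-- **Residues of an adjoined ring** (registered anchor): if the residues of `S` and of the
elements of `ws` lie in the residual subalgebra `T`, so do the residues of `k[S ∪ ws]` (all inside
`W`). [folklore] -/
theorem ap_residue_adjoin_mem : ∀ {k K : Type} [Field k] [Field K] [Algebra k K] (W : ValuationSubring K) [Algebra k (IsLocalRing.ResidueField W)] (T : Subalgebra k (IsLocalRing.ResidueField W)) (S : Subalgebra k K) (ws : Set K), (∀ r : K, r ∈ Algebra.adjoin k ((S : Set K) ∪ ws) → r ∈ W) → (∀ (r : K), r ∈ S → ∀ (hrW : r ∈ W), IsLocalRing.residue W ⟨r, hrW⟩ ∈ T) → (∀ w ∈ ws, ∀ (hwW : w ∈ W), IsLocalRing.residue W ⟨w, hwW⟩ ∈ T) → ∀ (r : K), r ∈ Algebra.adjoin k ((S : Set K) ∪ ws) → ∀ (hrW : r ∈ W), IsLocalRing.residue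 W ⟨r, hrW⟩ ∈ T := by
  intro k K _ _ _ W _ T S ws hAW hS hws r hr
  refine Algebra.adjoin_induction (p := fun r _ => ∀ (hrW : r ∈ W), residue W ⟨r, hrW⟩ ∈ T) ?_ ?_ ?_ ?_ hr
  · rintro w (hw | hw) hwW
    · exact hS w hw hwW
    · exact hws w hw hwW
  · intro c hcW; exact hS _ (S.algebraMap_mem c) hcW
  · intro w₁ w₂ hw₁ hw₂ h₁ h₂ hW'
    have hw₁W : w₁ ∈ W := hAW _ hw₁
    have hw₂W : w₂ ∈ W := hAW _ hw₂
    have : (⟨w₁ + w₂, hW'⟩ : W) = ⟨w₁, hw₁W⟩ + ⟨w₂, hw₂W⟩ := rfl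
    rw [this, map_add]; exact T.add_mem (h₁ hw₁W) (h₂ hw₂W)
  · intro w₁ w₂ hw₁ hw₂ h₁ h₂ hW'
    have hw₁W : w₁ ∈ W := hAW _ hw₁
    have hw₂W : w₂ ∈ W := hAW _ hw₂
    have : (⟨w₁ * w₂, hW'⟩ : W) = ⟨w₁, hw₁W⟩ * ⟨w₂, hw₂W⟩ := rfl
    rw [this, map_mul]; exact T.mul_mem (h₁ hw₁W) (h₂ hw₂W)

/-- **Lifting from an adjoined residual ring**: if every element of `T₀`, every `x̄s i` and every
scalar is the residue of an element of `S ⊆ W`, so is every element of `k[T₀ ∪ x̄s]`. [folklore] -/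
theorem ap_residue_adjoin_surj {k K : Type} [Field k] [Field K] [Algebra k K] (W : ValuationSubring K)
    [Algebra k (ResidueField W)] (T₀ : Set (ResidueField W)) {ι : Type} (xs : ι → ResidueField W)
    (S : Subalgebra k K) (hSW : S.toSubring ≤ W.toSubring)
    (halg : ∀ c : k, ∃ (w : K) (hw : w ∈ S), residue W ⟨w, hSW hw⟩ = algebraMap k (ResidueField W) c)
    (hT₀ : ∀ rb ∈ T₀, ∃ (w : K) (hw : w ∈ S), residue W ⟨w, hSW hw⟩ = rb)
    (hxs : ∀ i, ∃ (w : K) (hw : w ∈ S), residue W ⟨w, hSW hw⟩ = xs i) :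
    ∀ rb ∈ Algebra.adjoin k (T₀ ∪ Set.range xs), ∃ (w : K) (hw : w ∈ S), residue W ⟨w, hSW hw⟩ = rb := by
  intro rb hrb
  refine Algebra.adjoin_induction (p := fun rb _ => ∃ (w : K) (hw : w ∈ S), residue W ⟨w, hSW hw⟩ = rb)
    ?_ ?_ ?_ ?_ hrb
  · rintro rb (hrb | ⟨i, rfl⟩)
    · exact hT₀ rb hrb
    · exact hxs i
  · exact halg
  · rintro rb₁ rb₂ - - ⟨w₁, hw₁, rfl⟩ ⟨w₂, hw₂, rfl⟩
    exact ⟨w₁ + w₂, S.add_mem hw₁ hw₂, by rw [← map_add]; rfl⟩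
  · rintro rb₁ rb₂ - - ⟨w₁, hw₁, rfl⟩ ⟨w₂, hw₂, rfl⟩
    exact ⟨w₁ * w₂, S.mul_mem hw₁ hw₂, by rw [← map_mul]; rfl⟩

/-- **Value torsion in the residue field of the top coarsening.** [folklore] -/
theorem ap_ap_torsV {k K : Type} [Field k] [Field K] [Algebra k K] (O : ValuationSubring K) {n : ℕ}
    (R : Subalgebra k K) (hRO : R.toSubring ≤ O.toSubring) (x : Fin n → K) (hx : ∀ i, x i ∈ R)
    (hx0 : ∀ i, x i ≠ 0) (lv : Fin n → ℕ) (top : ℕ) (hle : ∀ i, lv i ≤ top)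
    (W : ValuationSubring K) (hOW : O ≤ W) (hWlow : ∀ i, lv i < top → W.valuation (x i) = 1)
    {nT : ℕ} (eT : Fin nT ≃ {i : Fin n // lv i = top})
    (hWind : ∀ m : Fin nT → ℤ, (∏ t, W.valuation (x (eT t)) ^ (m t)) = 1 → m = 0)
    {nS : ℕ} (eS : Fin nS ≃ {i : Fin n // lv i < top})
    (hlowW : ∀ i, lv i < top → x i ∈ W ∧ (x i)⁻¹ ∈ W)
    (htors : ∀ z : K, z ≠ 0 → ∃ N : ℕ, N ≠ 0 ∧ ∃ m : Fin n → ℤ,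
      O.valuation z ^ N = ∏ i, O.valuation (x i) ^ (m i)) :
    ∀ zb : ResidueField W, zb ≠ 0 → ∃ N : ℕ, N ≠ 0 ∧ ∃ m : Fin nS → ℤ,
      (residueValuationSubring O W hOW).valuation zb ^ N =
        ∏ s, (residueValuationSubring O W hOW).valuation
          (residue W ⟨x (eS s).1, hOW (hRO (hx (eS s).1))⟩) ^ (m s) := by
  classical
  set Ob := residueValuationSubring O W hOW with hOb
  have hprodK : ∀ m : Fin n → ℤ, O.valuation (∏ j, x j ^ (m j)) = ∏ j, O.valuation (x j) ^ (m j) := by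
    intro m; rw [map_prod]; exact Finset.prod_congr rfl fun j _ => map_zpow₀ _ _ _
  have hsplit := fun (N : Type) [CommMonoid N] (f : Fin n → N) => ap_prod_split lv top eT eS hle f
  have hmonW : ∀ m : Fin nS → ℤ, (∏ s, x (eS s) ^ (m s)) ∈ W := by
    intro m
    refine prod_mem fun s _ => ?_
    rcases Int.eq_nat_or_neg (m s) with ⟨N, hN | hN⟩
    · rw [hN, zpow_natCast]; exact pow_mem (hlowW _ (eS s).2).1 N
    · rw [hN, zpow_neg, zpow_natCast, ← inv_pow]; exact pow_mem (hlowW _ (eS s).2).2 N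
  have hmonu : ∀ m : Fin nS → ℤ, W.valuation (∏ s, x (eS s) ^ (m s)) = 1 := by
    intro m; rw [map_prod]; exact Finset.prod_eq_one fun s _ => by rw [map_zpow₀, hWlow _ (eS s).2, one_zpow]
  have hmonπ : ∀ m : Fin nS → ℤ, residue W ⟨∏ s, x (eS s) ^ (m s), hmonW m⟩ =
      ∏ s, residue W ⟨x (eS s).1, hOW (hRO (hx (eS s).1))⟩ ^ (m s) :=
    fun m => ap_residue_prod_zpow W (fun s => x (eS s)) (fun s => (hlowW _ (eS s).2).1)
      (fun s => (hlowW _ (eS s).2).2) (fun s => hx0 _) m (hmonW m)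
  have hmonOb : ∀ m : Fin nS → ℤ,
      (∏ s, Ob.valuation (residue W ⟨x (eS s).1, hOW (hRO (hx (eS s).1))⟩) ^ (m s)) =
      Ob.valuation (residue W ⟨∏ s, x (eS s) ^ (m s), hmonW m⟩) := by
    intro m; rw [hmonπ, map_prod]
    exact Finset.prod_congr rfl fun s _ => (map_zpow₀ _ _ _).symm
  have hmonO : ∀ m : Fin nS → ℤ, O.valuation (∏ s, x (eS s) ^ (m s)) = ∏ s, O.valuation (x (eS s)) ^ (m s) := by
    intro m; rw [map_prod]; exact Finset.prod_congr rfl fun s _ => map_zpow₀ _ _ _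
  -- `O`-units are `W`-units
  have hOW1 : ∀ z : K, O.valuation z = 1 → W.valuation z = 1 := by
    intro z hz
    have hz0 : z ≠ 0 := by rintro rfl; rw [map_zero] at hz; exact zero_ne_one hz
    rw [ap_valuation_eq_one_iff_mem_inv_mem W hz0]
    refine ⟨hOW ((O.valuation_le_one_iff _).mp hz.le), hOW ((O.valuation_le_one_iff _).mp ?_)⟩
    rw [map_inv₀, hz, inv_one]
  -- value torsion in the residue field
  have htorsV : ∀ zb : ResidueField W, zb ≠ 0 → ∃ N : ℕ, N ≠ 0 ∧ ∃ m : Fin nS → ℤ,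
      Ob.valuation zb ^ N = ∏ s, Ob.valuation (residue W ⟨x (eS s).1, hOW (hRO (hx (eS s).1))⟩) ^ (m s) := by
    intro zb hzb
    obtain ⟨y, rfl⟩ := residue_surjective zb
    have hyu : W.valuation (y : K) = 1 := by
      by_contra h1
      have hlt : W.valuation (y : K) < 1 := lt_of_le_of_ne ((W.valuation_le_one_iff _).mpr y.2) h1
      exact hzb ((ap_residue_eq_zero_iff W y.2).mpr hlt)
    have hy0 : (y : K) ≠ 0 := by rintro h0; rw [h0, map_zero] at hyu; exact zero_ne_one hyu
    obtain ⟨N, hN, m, hm⟩ := htors (y : K) hy0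
    have hyNu : W.valuation ((y : K) ^ N) = 1 := by rw [map_pow, hyu, one_pow]
    -- `x^m` is a `W`-unit
    have hxmW : W.valuation (∏ i, x i ^ (m i)) = 1 := by
      have hq : O.valuation ((∏ i, x i ^ (m i)) / (y : K) ^ N) = 1 := by
        rw [map_div₀, hprodK, ← hm, map_pow, div_self (pow_ne_zero _ ((map_ne_zero _).mpr hy0))]
      have : (∏ i, x i ^ (m i)) = ((∏ i, x i ^ (m i)) / (y : K) ^ N) * (y : K) ^ N := by
        rw [div_mul_cancel₀ _ (pow_ne_zero _ hy0)]
      rw [this, map_mul, hOW1 _ hq, hyNu, one_mul]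
    -- hence the top part of `m` vanishes
    have hmT : ∀ t, m (eT t) = 0 := by
      have h1 : (∏ t, W.valuation (x (eT t)) ^ (m (eT t))) = 1 := by
        have h2 : W.valuation (∏ i, x i ^ (m i)) = ∏ i, W.valuation (x i) ^ (m i) := by
          rw [map_prod]; exact Finset.prod_congr rfl fun i _ => map_zpow₀ _ _ _
        rw [h2, hsplit _ (fun i => W.valuation (x i) ^ (m i))] at hxmW
        have h3 : (∏ s, W.valuation (x (eS s)) ^ (m (eS s))) = 1 :=
          Finset.prod_eq_one fun s _ => by rw [hWlow _ (eS s).2, one_zpow]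
        rwa [h3, mul_one] at hxmW
      have := hWind (fun t => m (eT t)) h1
      exact fun t => congrFun this t
    -- the value of `y^N` is that of a lower monomial
    have hval : O.valuation ((y : K) ^ N) = O.valuation (∏ s, x (eS s) ^ (m (eS s))) := by
      rw [map_pow, hm, hsplit _ (fun i => O.valuation (x i) ^ (m i)), hmonO]
      have h3 : (∏ t, O.valuation (x (eT t)) ^ (m (eT t))) = 1 :=
        Finset.prod_eq_one fun t _ => by rw [hmT t, zpow_zero]
      rw [h3, one_mul]
    refine ⟨N, hN, fun s => m (eS s), ?_⟩
    rw [hmonOb]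
    have hres := (ap_resval_eq_iff O W hOW (W.pow_mem y.2 N) (hmonW fun s => m (eS s)) hyNu (hmonu _)).mpr hval
    rw [← hres, ← map_pow]
    rfl
  exact htorsV

/-- **The one-level case of S3***: a flag-adapted chart all of whose parameters have one level,
with value torsion, sits along a valuation of RANK ONE; the landed explicit rank-one
monomialization applies and its output is flag-adapted. [folklore] -/
theorem ap_ap_oneLevel {k K : Type} [Field k] [Field K] [Algebra k K] (O : ValuationSubring K) {n : ℕ}
    (R : Subalgebra k K) (hRO : R.toSubring ≤ O.toSubring) (x : Fin n → K) (hx : ∀ i, x i ∈ R)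
    (lv : Fin n → ℕ) (hRFG : R.FG) (hx0 : ∀ i, x i ≠ 0)
    (hspan : Ideal.span (Set.range fun i => (⟨x i, hx i⟩ : R.toSubring)) =
      Ideal.comap (Subring.inclusion hRO) (maximalIdeal O))
    (hind : ∀ m : Fin n → ℤ, (∏ i, O.valuation (x i) ^ (m i)) = 1 → m = 0)
    (hLA : LevelArchimedean (fun i => O.valuation (x i)) lv)
    (htors : ∀ z : K, z ≠ 0 → ∃ N : ℕ, N ≠ 0 ∧ ∃ m : Fin n → ℤ,
      O.valuation z ^ N = ∏ i, O.valuation (x i) ^ (m i))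
    (top : ℕ) (hone : ∀ i, lv i = top)
    {ma : ℕ} (a : Fin ma → K) (ha : ∀ j, a j ∈ R ∧ a j ≠ 0)
    {l : ℕ} (h : Fin l → Fin n → ℤ) (hh : ∀ j, (∏ i, O.valuation (x i) ^ (h j i)) ≤ 1) :
    ∃ (R' : Subalgebra k K) (hR'O : R'.toSubring ≤ O.toSubring) (x' : Fin n → K)
      (hx' : ∀ i, x' i ∈ R') (lv' : Fin n → ℕ),
      R ≤ R' ∧ R' = Algebra.adjoin k ((R : Set K) ∪ Set.range x') ∧
      FlagAdaptedChart O R' hR'O x' hx' lv' ∧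
      (∀ j, ∃ c : Fin n → ℤ, x' j = ∏ i, x i ^ (c i)) ∧
      (∀ i, ∃ d : Fin n → ℕ, x i = ∏ j, x' j ^ (d j)) ∧
      (∀ j, ∃ (α : Fin n → ℕ) (u : K), u ∈ R' ∧ O.valuation u = 1 ∧
        a j = (∏ i, x' i ^ (α i)) * u) ∧
      (∀ j, ∃ e : Fin n → ℕ, (∏ i, x i ^ (h j i)) = ∏ i, x' i ^ (e i)) := by
  classical
  have hvx0 : ∀ i, O.valuation (x i) ≠ 0 := fun i => (map_ne_zero _).mpr (hx0 i)
  have hprodK : ∀ m : Fin n → ℤ, O.valuation (∏ j, x j ^ (m j)) = ∏ j, O.valuation (x j) ^ (m j) := by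
    intro m; rw [map_prod]; exact Finset.prod_congr rfl fun j _ => map_zpow₀ _ _ _
  have hr1 : ∀ z w : K, O.valuation z < 1 → w ≠ 0 → ∃ N : ℕ, O.valuation z ^ N < O.valuation w := by
    intro z w hz hw
    by_cases hz0 : z = 0
    · refine ⟨1, ?_⟩; rw [hz0, map_zero, pow_one]; exact (Valuation.pos_iff _).mpr hw
    obtain ⟨N₁, hN₁, a₁, ha₁⟩ := htors z hz0
    obtain ⟨N₂, hN₂, b₁, hb₁⟩ := htors w hw
    have hsm : ∀ m : Fin n → ℤ, (∀ j, top ≤ lv j → m j = 0) →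
        (∏ j, O.valuation (x j) ^ (a₁ j)) < ∏ j, O.valuation (x j) ^ (m j) := by
      intro m hm
      have hm0 : m = 0 := funext fun j => hm j (hone j).ge
      rw [hm0]; simp only [Pi.zero_apply, zpow_zero, Finset.prod_const_one]
      rw [← ha₁]; exact pow_lt_one₀ zero_le hz hN₁
    obtain ⟨M, hM⟩ := hLA top a₁ b₁ (fun j hj => absurd (hone j) hj) (fun j hj => absurd (hone j) hj) hsm
    rw [← ha₁, ← hb₁, ← pow_mul] at hM
    rcases le_or_gt 1 (O.valuation w) with hw1 | hw1
    · exact ⟨1, by rw [pow_one]; exact lt_of_lt_of_le hz hw1⟩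
    · exact ⟨N₁ * M, lt_of_lt_of_le hM (pow_le_of_le_one zero_le hw1.le hN₂)⟩
  obtain ⟨R', hR'O, x', hx', hRR', hR'FG, hsub, hx'0, hspan', hind', hxd, haj, hhj, hR'eq, hx'c, hx'lt⟩ :=
    perronMonomialization_explicit k K O n R hRO x hx hRFG hx0 hspan hind hr1 ma a ha l h hh
  have hvx'0 : ∀ i, O.valuation (x' i) ≠ 0 := fun i => (map_ne_zero _).mpr (hx'0 i)
  have hprodK' : ∀ m : Fin n → ℤ, O.valuation (∏ j, x' j ^ (m j)) = ∏ j, O.valuation (x' j) ^ (m j) := by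
    intro m; rw [map_prod]; exact Finset.prod_congr rfl fun j _ => map_zpow₀ _ _ _
  have hpos' : ∀ m : Fin n → ℤ, 0 < ∏ j, O.valuation (x' j) ^ (m j) := fun m =>
    Finset.prod_pos fun j _ => zpow_pos (zero_lt_iff.mpr (hvx'0 j)) _
  have hx'K0 : ∀ m : Fin n → ℤ, (∏ j, x' j ^ (m j)) ≠ 0 := fun m => ap_prod_zpow_ne_zero x' hx'0 m
  refine ⟨R', hR'O, x', hx', fun _ => top, hRR', hR'eq, ⟨⟨hR'FG, hx'0, hspan', hind', ⟨?_, ?_, ?_⟩, ?_⟩, ?_⟩,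
    hx'c, hxd, haj, hhj⟩
  · intro i i' hii'; exact absurd hii' (lt_irrefl _)
  · intro i i' _; exact hr1 (x' i) (x' i') (hx'lt i) (hx'0 i')
  · intro ℓ μ hμ hμ0
    by_cases hℓ : ℓ = top
    · subst hℓ
      have hne : (∏ j, O.valuation (x' j) ^ (μ j)) ≠ 1 := fun h1 => hμ0 (hind' μ h1)
      rcases lt_or_gt_of_ne hne with hlt | hgt
      · left; intro m hm
        have hm0 : m = 0 := funext fun j => hm j le_rfl
        rw [hm0]; simpa using hlt
      · right; intro m hm
        have hm0 : m = 0 := funext fun j => hm j le_rfl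
        rw [hm0]; simpa using hgt
    · exfalso; apply hμ0; funext j; exact hμ j (fun h => hℓ h.symm)
  · intro ℓ z
    by_cases hℓ : ℓ ≤ top
    · have hset : Set.range (fun i : {i : Fin n // ℓ ≤ (fun _ => top) i} => (⟨x' i.1, hx' i.1⟩ : R'.toSubring)) =
          Set.range (fun i => (⟨x' i, hx' i⟩ : R'.toSubring)) := by
        ext t; constructor
        · rintro ⟨i, rfl⟩; exact ⟨i.1, rfl⟩
        · rintro ⟨i, rfl⟩; exact ⟨⟨i, hℓ⟩, rfl⟩
      rw [hset, hspan', Ideal.mem_comap, ValuationSubring.valuation_lt_one_iff]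
      change O.valuation (z : K) < 1 ↔ _
      constructor
      · intro hz m hm
        have hm0 : m = 0 := funext fun j => hm j hℓ
        rw [hm0]; simpa using hz
      · intro h
        simpa using h 0 (fun _ _ => rfl)
    · push Not at hℓ
      have hset : Set.range (fun i : {i : Fin n // ℓ ≤ (fun _ => top) i} => (⟨x' i.1, hx' i.1⟩ : R'.toSubring)) = ∅ :=
        Set.range_eq_empty_iff.mpr ⟨fun i => absurd i.2 (not_le.mpr hℓ)⟩
      rw [hset, Ideal.span_empty, Ideal.mem_bot]
      constructor
      · rintro rfl m -
        simp only [ZeroMemClass.coe_zero, map_zero]; exact hpos' m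
      · intro h
        by_contra hz0
        have hz0' : (z : K) ≠ 0 := fun h0 => hz0 (Subtype.ext h0)
        obtain ⟨N, hN, m₀, hm₀⟩ := htors (z : K) hz0'
        -- `x^{m₀}` is a Laurent monomial in `x'`
        choose d hd using hxd
        have hxm : (∏ i, O.valuation (x i) ^ (m₀ i)) =
            ∏ j, O.valuation (x' j) ^ (∑ i, m₀ i * (d i j : ℤ)) := by
          rw [← hprodK, ← hprodK']
          congr 1
          have : ∀ i, x i = ∏ j, x' j ^ ((d i j : ℤ)) := fun i => by rw [hd i]; exact ap_prod_pow_eq_zpow _ _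
          simp_rw [this]
          exact ap_prod_zpow_matrix x' hx'0 (fun i j => (d i j : ℤ)) m₀
        have h1 := h (fun j => ∑ i, m₀ i * (d i j : ℤ)) (fun j hj => absurd hj (not_le.mpr hℓ))
        rw [← hxm, ← hm₀] at h1
        have hzle : O.valuation (z : K) ≤ 1 := (O.valuation_le_one_iff _).mpr (hR'O z.2)
        exact absurd (pow_le_of_le_one zero_le hzle hN) (not_le.mpr h1)
  · intro ℓ μ μ' hμ hμ' hsm
    by_cases hℓ : ℓ = top
    · subst hℓ
      have hlt : O.valuation (∏ j, x' j ^ (μ j)) < 1 := by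
        rw [hprodK']; simpa using hsm 0 (fun _ _ => rfl)
      obtain ⟨N, hN⟩ := hr1 _ (∏ j, x' j ^ (μ' j)) hlt (hx'K0 μ')
      exact ⟨N, by rw [← hprodK', ← hprodK']; exact hN⟩
    · exfalso
      have hμ0 : μ = 0 := funext fun j => hμ j (fun h => hℓ h.symm)
      have h1 := hsm 0 (fun _ _ => rfl)
      rw [hμ0] at h1; exact lt_irrefl _ h1
end Summit.ResolutionOfSingularities.ResolutionOfSingularities.Theorems.PfaffLine
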